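import Mathlib.LinearAlgebra.Lagrange
import Literature.AlgebraicGeometry.Motives.MumfordTateInvariantsStableSubspace
import Literature.AlgebraicGeometry.Motives.MumfordTateInvariantsTensorPolarization
import Literature.AlgebraicGeometry.Motives.HodgeStructureSubstructures
import HarnessLib

/-!
# `MT(ℚ)`-stable subspaces of `T^{a,b}` underlie sub-Hodge structures (Mumford–Tate invariants, step 20)

For a pure `ℚ`-Hodge structure `H` on a finite-dimensional `V` and an `MT(H)(ℚ)`-stable rational
subspace `W ⊆ T^{a,b}` we construct the sub-Hodge structure of `T^{a,b} H` on `W`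
(`exists_subHodgeStructure_of_mumfordTateGroup_stable`), i.e. Green–Griffiths–Kerr,
*Mumford–Tate groups and domains*, (I.B.5) ("a subspace `W ⊂ T^{k,l}` is a sub-Hodge structure
iff it is `M`-stable"), the direction `⇐`, on `ℚ`-points.

Proof: by `MumfordTateInvariantsStableSubspace`, `W_ℂ` is stable under the Hodge grading
operator `ρ(Θ)` of a graded basis `e` of `V_ℂ` (through the Lie algebra `𝔰`), which is diagonal
on the tensor basis `E = hodgeTensorBasisBC e a b` of `ℂ ⊗ T^{a,b}` with eigenvalue the total
degree. The Lagrange interpolation polynomials on the finitely many degrees give projectors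
`π_P`, polynomials in `ρ(Θ)`, onto the spans of the `E x` of degree `P` — the Hodge pieces
`T^{P, w-P}` (`tensorSpace_piece_eq_span`) — so `W_ℂ ⊆ Σ_P (W_ℂ ∩ T^{P,w-P})`, which is the
tree's criterion `SubHodgeStructure.exists_eq_of_baseChange_le` (Voisin I, Def. 7.24).

## References

* M. Green, P. Griffiths, M. Kerr, *Mumford–Tate groups and domains* (2012), (I.B.5).
* C. Voisin, *Hodge Theory and Complex Algebraic Geometry I* (2002), §7.3.1, Def. 7.24.
* P. Deligne, *Hodge cycles on abelian varieties*, LNM 900 (1982), I, proof of Prop. 3.4.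
-/

noncomputable section

open scoped TensorProduct
open Polynomial

namespace Literature.AlgebraicGeometry.Motives

namespace HodgeStructure

universe u

/-! ### Polynomials of an operator preserve its stable subspaces -/

/-- If `N` is `T`-stable then `N` is stable under every polynomial in `T`. [folklore] -/
theorem aeval_apply_mem_of_forall_mem {K : Type*} [Field K] {M : Type*} [AddCommGroup M]
    [Module K M] (T : Module.End K M) (N : Submodule K M) (hN : ∀ x ∈ N, T x ∈ N) (p : K[X])
    {x : M} (hx : x ∈ N) : aeval T p x ∈ N := by
  have hpow : ∀ (i : ℕ) (y : M), y ∈ N → (T ^ i) y ∈ N := by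
    intro i
    induction i with
    | zero => intro y hy; simpa using hy
    | succ i ih =>
      intro y hy
      rw [pow_succ', Module.End.mul_apply]
      exact hN _ (ih y hy)
  rw [aeval_eq_sum_range, LinearMap.sum_apply]
  exact Submodule.sum_mem _ fun i _ => by
    rw [LinearMap.smul_apply]
    exact Submodule.smul_mem _ _ (hpow i x hx)

variable {V : Type u} [AddCommGroup V] [Module ℚ V] [Module.Finite ℚ V] {n : ℤ}

/-- **The grading operator transported to `ℂ ⊗ T^{a,b}`** along the comparison isomorphism:
`Θ' = ι⁻¹ ∘ ρ(Θ) ∘ ι`. [folklore] -/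
def gradingEndBC {S : Type u} [Fintype S] [DecidableEq S] (e : Module.Basis S ℂ (ℂ ⊗[ℚ] V))
    (deg : S → ℤ) (a b : ℕ) : Module.End ℂ (ℂ ⊗[ℚ] hodgeTensorSpace V a b) :=
  (hodgeTensorSpaceBaseChange V a b).symm.toLinearMap ∘ₗ
    tensorDerivation a b (gradingEnd e deg) ∘ₗ (hodgeTensorSpaceBaseChange V a b).toLinearMap

/-- `Θ'` is diagonal on the tensor basis `E` of `ℂ ⊗ T^{a,b}` with eigenvalue the total degree.
[folklore] -/
theorem gradingEndBC_basis {S : Type u} [Fintype S] [DecidableEq S] (e : Module.Basis S ℂ (ℂ ⊗[ℚ] V))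
    (deg : S → ℤ) {a b : ℕ} (x : (Fin a → S) × (Fin b → S)) :
    gradingEndBC e deg a b (hodgeTensorBasisBC e a b x) =
      (tensorDegree deg x : ℂ) • hodgeTensorBasisBC e a b x := by
  simp only [gradingEndBC, LinearMap.comp_apply, LinearEquiv.coe_coe,
    hodgeTensorSpaceBaseChange_hodgeTensorBasisBC, tensorDerivation_gradingEnd_hodgeTensorBasis,
    map_smul]
  rw [← hodgeTensorSpaceBaseChange_hodgeTensorBasisBC, LinearEquiv.symm_apply_apply]

variable [HodgeTensorFacts.{u, u}]

/-- `W_ℂ = W.baseChange ℂ` is `Θ'`-stable for an `MT(ℚ)`-stable `W`. [folklore] -/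
theorem gradingEndBC_apply_mem (H : HodgeStructure V n) {S : Type u} [Fintype S] [DecidableEq S]
    {deg : S → ℤ} (e : Module.Basis S ℂ (ℂ ⊗[ℚ] V))
    (hF : ∀ p, H.F p = Submodule.span ℂ (e '' {σ | p ≤ deg σ}))
    (hFc : ∀ p, complexConj (H.F p) = Submodule.span ℂ (e '' {σ | deg σ ≤ n - p})) {a b : ℕ}
    (W : Submodule ℚ (hodgeTensorSpace V a b))
    (hW : ∀ g ∈ H.mumfordTateGroup, ∀ w ∈ W, tensorSpaceAct g w ∈ W)
    {x : ℂ ⊗[ℚ] hodgeTensorSpace V a b} (hx : x ∈ W.baseChange ℂ) :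
    gradingEndBC e deg a b x ∈ W.baseChange ℂ := by
  have hx' : hodgeTensorSpaceBaseChange V a b x ∈ subspaceBaseChange V W :=
    Submodule.mem_map_of_mem hx
  have h := subspaceBaseChange_gradingEnd_stable_of_mumfordTateGroup_stable H e hF hFc W hW hx'
  rw [subspaceBaseChange, Submodule.mem_map_equiv] at h
  exact h

/-- **An `MT(H)(ℚ)`-stable rational subspace of `T^{a,b}` underlies a sub-Hodge structure of
`T^{a,b} H`** (Green–Griffiths–Kerr (I.B.5), `⇐`, on `ℚ`-points; Deligne I, proof of 3.4).
[cite: GreenGriffithsKerr2012, I.B.5] -/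
theorem exists_subHodgeStructure_of_mumfordTateGroup_stable (H : HodgeStructure V n) {a b : ℕ}
    (W : Submodule ℚ (hodgeTensorSpace V a b))
    (hW : ∀ g ∈ H.mumfordTateGroup, ∀ w ∈ W, tensorSpaceAct g w ∈ W) :
    ∃ S : SubHodgeStructure (H.tensorSpace a b), S.toSubmodule = W := by
  classical
  obtain ⟨S, deg, e, hF, hFc⟩ := exists_basis_F_eq_span H
  haveI : Fintype S := FiniteDimensional.fintypeBasisIndex e
  refine SubHodgeStructure.exists_eq_of_baseChange_le W fun x hx => ?_
  -- the transported grading operator and its Lagrange projectors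
  set Θ := gradingEndBC e deg a b with hΘ
  set E := hodgeTensorBasisBC e a b with hE
  have hdiag : ∀ k, Θ (hodgeTensorBasisBC e a b k) = (tensorDegree deg k : ℂ) • hodgeTensorBasisBC e a b k :=
    gradingEndBC_basis e deg
  set D : Finset ℤ := Finset.univ.image (tensorDegree deg (a := a) (b := b)) with hD
  set Dc : Finset ℂ := D.image (fun d : ℤ => (d : ℂ)) with hDc
  have hinj : Set.InjOn (id : ℂ → ℂ) Dc := Function.injective_id.injOn
  -- `π_P = L_P(Θ)` with `L_P` the Lagrange basis polynomial at the node `P`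
  have hπ : ∀ (P : ℤ) (k : (Fin a → S) × (Fin b → S)), P ∈ D →
      aeval Θ (Lagrange.basis Dc id (P : ℂ)) (hodgeTensorBasisBC e a b k) =
        (if tensorDegree deg k = P then (1 : ℂ) else 0) • hodgeTensorBasisBC e a b k := by
    intro P k hP
    have h := @Module.End.aeval_apply_of_mem_apply_eq_smul ℂ (ℂ ⊗[ℚ] hodgeTensorSpace V a b) _ _ _
      Θ (tensorDegree deg k : ℂ) (hodgeTensorBasisBC e a b k) (Lagrange.basis Dc id (P : ℂ)) (hdiag k)
    rw [h]
    congr 1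
    have hk : ((tensorDegree deg k : ℤ) : ℂ) ∈ Dc :=
      Finset.mem_image_of_mem _ (Finset.mem_image_of_mem _ (Finset.mem_univ k))
    by_cases hkP : tensorDegree deg k = P
    · rw [if_pos hkP, hkP]
      exact Lagrange.eval_basis_self (v := id) hinj (Finset.mem_image_of_mem _ hP)
    · rw [if_neg hkP]
      have hne : ((P : ℤ) : ℂ) ≠ ((tensorDegree deg k : ℤ) : ℂ) := fun h =>
        hkP (Int.cast_injective h).symm
      exact Lagrange.eval_basis_of_ne (v := id) hne hk
  -- `x = Σ_{P ∈ D} π_P x`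
  have hsum : x = ∑ P ∈ D, aeval Θ (Lagrange.basis Dc id (P : ℂ)) x := by
    conv_lhs => rw [← (hodgeTensorBasisBC e a b).sum_repr x]
    conv_rhs => rw [← (hodgeTensorBasisBC e a b).sum_repr x]
    simp_rw [map_sum, map_smul]
    rw [Finset.sum_comm]
    refine Finset.sum_congr rfl fun k _ => ?_
    rw [← Finset.smul_sum]
    congr 1
    rw [Finset.sum_congr rfl fun P hP => hπ P k hP, ← Finset.sum_smul, Finset.sum_ite_eq,
      if_pos (Finset.mem_image_of_mem _ (Finset.mem_univ k)), one_smul]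
  -- each `π_P x` lies in `W_ℂ ∩ T^{P, w-P}`
  rw [hsum]
  refine Submodule.sum_mem _ fun P hP => ?_
  refine Submodule.mem_iSup_of_mem P ⟨?_, ?_⟩
  · exact aeval_apply_mem_of_forall_mem Θ _ (fun y hy => gradingEndBC_apply_mem H e hF hFc W hW hy) _ hx
  · rw [tensorSpace_piece_eq_span H e hF hFc a b (show P + ((((a : ℤ) - b) * n) - P) =
      ((a : ℤ) - b) * n by ring)]
    have hx' : aeval Θ (Lagrange.basis Dc id (P : ℂ)) x =
        ∑ k, (hodgeTensorBasisBC e a b).repr x k •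
          aeval Θ (Lagrange.basis Dc id (P : ℂ)) (hodgeTensorBasisBC e a b k) := by
      conv_lhs => rw [← (hodgeTensorBasisBC e a b).sum_repr x]
      simp_rw [map_sum, map_smul]
    rw [hx']
    refine Submodule.sum_mem _ fun k _ => Submodule.smul_mem _ _ ?_
    rw [hπ P k hP]
    by_cases hk : tensorDegree deg k = P
    · rw [if_pos hk, one_smul]
      exact Submodule.subset_span ⟨k, hk, rfl⟩
    · rw [if_neg hk, zero_smul]
      exact Submodule.zero_mem _

end HodgeStructure

end Literature.AlgebraicGeometry.Motives

end
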